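import Mathlib
import HarnessLib
import Summits.HubbardSuperconductivity.HubbardSuperconductivity.Theorems.KLProgrammeKLRegimeTwoVolumeMomentumReadoutPin
import Summits.HubbardSuperconductivity.HubbardSuperconductivity.Theorems.KLProgrammeKLRegimeVolumeLimitFlowFramesV17F2
import Summits.HubbardSuperconductivity.HubbardSuperconductivity.Theorems.KLProgrammeKLRegimeVolumeLimitPerSite
import Summits.HubbardSuperconductivity.HubbardSuperconductivity.Theorems.KLProgrammeKLRegimeSplitThermalLayer

/-!
# Route `KLProgramme` — crux K3, VL child `KLRegimeVolumeLimitV17F2` (stmt-HubbardSuperconductivity-20440): THE REGISTERED STUB TEXT FROM THE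
# LAST-SCALE PINNED GRID DEFECT — ROUTE A's target (A3) ∘ (A5) fixed in Lean
# (cell gate-hubbard-kl, seat hubbard-kl-k3c5-p3 g9, technique «OS-positivity-free direct assembly»)

ROUTE A for `stub_vl_nestedFramed` («cauchy v8-F2» 1029f7bae705461f) ends with (A3): the inductive two-volume comparison of the flows of `L ∣ L″`
at deep pins, whose last-scale output is the PINNED TWO-LEG GRID DEFECT `Def_w(W̃_L^{K_L}, W̃_{L″}^{K_{L″}})` between the grid actions of the purely
quartic K-resummed theories at the last scale `n_β + 1`, each volume in its OWN flow frame `K_V = klFlowFrameU V M β U μ (n_β+1)` (k3c5-p2's β′ currency,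
`…TwoVolumeReadoutPin`), read through this seat's `…TwoVolumeMomentumReadoutPin.norm_klSelfEnergy_sub_le_gridDefect_pin` ((A5) at a grid momentum).
This file turns «that defect tends to zero» into the registered stub text VERBATIM:

* §1 symbol facts at FIXED `β` (no rate is asked by the stub, so soft analysis suffices): the resummation denominator `1 + u·κ` never vanishes
  (`one_add_uvSymbolFn_mul_ne_zero`), `e ↦ Ψ̂(e)` is continuous (`continuous_uvSymbolFn_band`), hence the explicit symbols `E_K(p) = κ − κ²ũ`,
  `τ_K(p) = (1 − κũ)²` (`κ = K(p)`, `ũ = u(e−κ)/(1+u(e−κ)κ)`) are continuous functions of `(κ, e)` on the compact `[−Kmax,Kmax] × [−4−|μ|, 4+|μ|]`,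
  so UNIFORMLY continuous and bounded; with the tower's frame comparability `sup_q |K^{(L,M)}(q) − K^{(L″,M)}(q)| ≤ (Σ_m Q.CL β m)/L`
  (`flowFrames_twoVolume_of_towerV17F2`) and sup bound (`abs_eval_klFlowFrameU_le_of_towerV17F2`) the symbol terms of the read-out are `≤ η(L) → 0`
  (one null rate via `exists_rate_of_forall_eps`).
* §2 **`framedNestedFlowTextV17F2_of_lastScaleGridDefectText`**: inside the regime binders and under the tower, IF for every Matsubara integer `n` there are
  `L₀`, `B` and `δ → 0` such that for `L ≥ L₀`, `L″ = b·L`, eventually in the common cutoff `M`, on some grid `N` (`2M ≤ N`, `4M ≤ N+1`) with unit framed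
  partition functions and at some fine pin `w`: `(2N/|β|)·N₂(W̃_L; ō_w) ≤ B` and `(2N/|β|)·Def_w(W̃_L^{K_L}, W̃_{L″}^{K_{L″}}) ≤ δ L` at every label of
  integer `n` — THEN the stub text holds (rate `ρ = η_E + η_τ·B + T_max·δ`).
* §3 `volumeLimitTextV17F2_of_lastScaleGridDefectText` — hence the VL child text `VolumeLimitP2 klPredsV17F2 FinalTwoLegVolLimitEx klWindowC`
  (∘ `volumeLimitTextV17F2_of_framedNestedFlowText`).

Proofs only; no definition; nothing is asserted about the model.  References: BGM 2006 §2.4 (2.38), Lemmas 2.4–2.5; FST 1996 §1.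
-/

noncomputable section

namespace Summit.HubbardSuperconductivity.HubbardSuperconductivity.Theorems.TwoPointAssembly

set_option linter.dupNamespace false -- summit = problem name (single-conjunct summit), D-0017

open Finset Filter Topology Literature.MathematicalPhysics.QuantumLattice GrassmannAlgebra Literature.Probability.LatticeModels
open Summit.HubbardSuperconductivity.HubbardSuperconductivity.Theorems.KLRegimeSplit
open Summit.HubbardSuperconductivity.HubbardSuperconductivity.Theorems.KLProgrammeLegKernels

/-! ## §1 Symbol facts at fixed `β`: non-vanishing denominator, continuity -/

/-- **The resummation denominator never vanishes in the continuum**: `1 + Ψ̂_c(x, ν)·κ ≠ 0` for `ν ≠ 0` and real `x, κ`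
(`Ψ̂ = w·c/(−iν + x)`, so `1 + Ψ̂κ = (−iν + x + wcκ)/(−iν + x)` has a numerator with imaginary part `−ν`). [cite: FeldmanSalmhoferTrubowitz1996, §1] -/
theorem one_add_uvSymbolFn_mul_ne_zero {ν : ℝ} (hν : ν ≠ 0) (c Λ x κ : ℝ) : (1 : ℂ) + uvSymbolFn c Λ x ν * (κ : ℂ) ≠ 0 := by
  set z : ℂ := -Complex.I * ((ν + 0 : ℝ) : ℂ) + (x : ℂ) with hz_def
  have hz : z ≠ 0 := by
    intro h
    have := congrArg Complex.im h
    simp [hz_def] at this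
    exact hν this
  have hu : uvSymbolFn c Λ x ν = (uvWeightFn Λ x ν : ℂ) * ((c : ℂ) / z) := by
    simp only [uvSymbolFn, resolventFn, hz_def]
  rw [hu]
  have hrew : (1 : ℂ) + (uvWeightFn Λ x ν : ℂ) * ((c : ℂ) / z) * (κ : ℂ) = (z + (uvWeightFn Λ x ν : ℂ) * (c : ℂ) * (κ : ℂ)) / z := by
    field_simp
  rw [hrew]
  refine div_ne_zero ?_ hz
  intro h
  have := congrArg Complex.im h
  simp [hz_def] at this
  exact hν this

/-- **`x ↦ Ψ̂_c(x, ν)` is continuous** (`0 < Λ`): it is differentiable in the band variable everywhere ([tree] `hasDerivAt_uvSymbolFnXi`).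
[cite: BenfattoGiulianiMastropietro2006, §2.3 (2.36)] -/
theorem continuous_uvSymbolFn_band (c : ℝ) {Λ : ℝ} (hΛ : 0 < Λ) (ν : ℝ) : Continuous fun x : ℝ => uvSymbolFn c Λ x ν := by
  have h : (fun x : ℝ => uvSymbolFn c Λ x ν) = uvSymbolFnXi c Λ ν := funext fun x => uvSymbolFn_eq_uvSymbolFnXi c Λ x ν
  rw [h]
  exact continuous_iff_continuousAt.2 fun e => (hasDerivAt_uvSymbolFnXi (c := c) (ω := ν) hΛ e).continuousAt

/-- A uniformly continuous map on a compact rectangle: `ε`-closeness of the values at `(κ,e)`, `(κ′,e)` once `|κ − κ′| ≤ C/L`, `L` large. [folklore] -/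
theorem exists_threshold_of_uniformContinuousOn {Φ : ℝ × ℝ → ℂ} {Kmax emax : ℝ}
    (hΦ : UniformContinuousOn Φ (Set.Icc (-Kmax) Kmax ×ˢ Set.Icc (-emax) emax)) {C : ℝ} (hC : 0 ≤ C) {ε : ℝ} (hε : 0 < ε) :
    ∃ L₁ : ℕ, ∀ L : ℕ, L₁ ≤ L → ∀ κ κ' e : ℝ, |κ| ≤ Kmax → |κ'| ≤ Kmax → |e| ≤ emax → |κ - κ'| ≤ C / L →
      ‖Φ (κ, e) - Φ (κ', e)‖ ≤ ε := by
  rw [Metric.uniformContinuousOn_iff] at hΦ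
  obtain ⟨θ, hθ, h⟩ := hΦ ε hε
  obtain ⟨L₁, hL₁⟩ := exists_nat_gt (C / θ)
  refine ⟨L₁, fun L hL κ κ' e hκ hκ' he hd => ?_⟩
  have hL₁pos : (0 : ℝ) < L₁ := lt_of_le_of_lt (by positivity) hL₁
  have hLpos : (0 : ℝ) < L := lt_of_lt_of_le hL₁pos (by exact_mod_cast hL)
  have hCL : C / L < θ := by
    rw [div_lt_iff₀ hLpos]
    have h1 : C < θ * L₁ := by rwa [div_lt_iff₀ hθ, mul_comm] at hL₁
    exact h1.trans_le (mul_le_mul_of_nonneg_left (by exact_mod_cast hL) hθ.le)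
  have hmem : (κ, e) ∈ Set.Icc (-Kmax) Kmax ×ˢ Set.Icc (-emax) emax := ⟨abs_le.1 hκ, abs_le.1 he⟩
  have hmem' : (κ', e) ∈ Set.Icc (-Kmax) Kmax ×ˢ Set.Icc (-emax) emax := ⟨abs_le.1 hκ', abs_le.1 he⟩
  have hdist : dist (κ, e) (κ', e) < θ := by
    rw [Prod.dist_eq, dist_self, max_eq_left dist_nonneg, Real.dist_eq]
    exact hd.trans_lt hCL
  have hlt := h _ hmem _ hmem' hdist
  rw [dist_eq_norm] at hlt
  exact hlt.le

/-! ## §2 The registered stub text from the last-scale pinned grid defect -/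

/-- Shorthand-free statement.  With `n⋆ = nScales β + 1`, `Λ⋆ = klScale klE0 n⋆`, `K_V = klFlowFrameU V M β U μ n⋆` (`V = L, L″`), the resummed symbols
`p̃^{K}_V = p^{K}_V/(1 + p^{K}_V·K/(βV²))` and THE grid actions `W̃_V = effAction (S_Vᵀ·normalCovariance p̃^{K_V}_V·S_V) (hubbardGridInteraction V N β U)`,
`S_V = hubbardGridSub V M β N`; pins `ō = (w.1, c̄)`, `c̄ = (r₀,r₀)`, `r₀ = (L−1)/2`, `ι p = (p.1, w.2 + clift(p.2 − c̄))`.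

**THE STUB TEXT OF «cauchy v8-F2» FROM THE LAST-SCALE PINNED GRID DEFECT.**  If, inside the regime binders and under the tower, for every Matsubara
integer `n` there are `L₀`, `B`, `δ → 0` such that for all `L ≥ L₀`, all `L″ = b·L`, eventually in the common cutoff `M`, there is a time grid `N`
(`2M ≤ N`, `4M ≤ N + 1`) with unit framed partition functions at both volumes and a fine pin `w` at which, for every label `ω` of integer `n`,
`(2N/|β|)·Σ_{p₁}‖W̃_L(ō,p₁)‖ ≤ B` and `(2N/|β|)·[Σ_{p₁}‖W̃_L(ō,p₁) − W̃_{L″}(w,ιp₁)‖ + Σ_{p₁′∉range ι}‖W̃_{L″}(w,p₁′)‖] ≤ δ L`, then the framed nested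
comparability text `stub_vl_nestedFramed` holds, with rate `ρ = η_E + η_τ·B + T·δ` (`η_E, η_τ → 0` the symbol moduli from frame comparability).
[cite: BenfattoGiulianiMastropietro2006, §2.4 (2.38)] -/
theorem framedNestedFlowTextV17F2_of_lastScaleGridDefectText
    (hD : ∀ (G : GeoConsts) (P : SplitConsts) (Q : EngConsts) (R : RenConsts), G.WF → P.WF → Q.WF → R.WF →
      ∃ c₅ : ℝ, 0 < c₅ ∧ ∀ c : ℝ, 0 < c → c ≤ c₅ → ∃ U₀ : ℝ, 0 < U₀ ∧
        ∀ μ ∈ klWindowC, ∀ U : ℝ, 0 < U → U ≤ U₀ → ∀ β : ℝ, klBetaMin ≤ β → β ≤ Real.exp (c / U ^ 2) →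
          ∀ K : TrigPolyC4v, klPredsV17F2.frameOK R U (nScales β) μ K →
            ∀ (Lstar : ℕ) (Mstar : ℕ → ℕ), TowerP klPredsV17F2 G P Q R β U μ K Lstar Mstar →
              ∀ n : ℤ, ∃ L₀ : ℕ, ∃ B : ℝ, ∃ δ : ℕ → ℝ, Tendsto δ atTop (𝓝 0) ∧
                ∀ (L : ℕ) [NeZero L], L₀ ≤ L → ∀ (L'' : ℕ) [NeZero L''] (b : ℕ), L'' = b * L → ∃ M₀ : ℕ, ∀ (M : ℕ) [NeZero M], M₀ ≤ M →
                  ∃ (N : ℕ) (_ : NeZero N), 2 * M ≤ N ∧ 4 * M ≤ N + 1 ∧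
                    IsUnit (effPartitionFn ℂ (normalCovariance L M (uvSymbolCT L M β μ (klFlowFrameU L M β U μ (nScales β + 1))
                      (klScale klE0 (nScales β + 1))))
                      (hubbardInteraction L M β U + counterQuadratic L M β (klFlowFrameU L M β U μ (nScales β + 1)))) ∧
                    IsUnit (effPartitionFn ℂ (normalCovariance L'' M (uvSymbolCT L'' M β μ (klFlowFrameU L'' M β U μ (nScales β + 1))
                      (klScale klE0 (nScales β + 1))))
                      (hubbardInteraction L'' M β U + counterQuadratic L'' M β (klFlowFrameU L'' M β U μ (nScales β + 1)))) ∧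
                    ∃ w : GridPoint L'' N, ∀ ω : MatsubaraIdx M, matsubaraInt M ω = n →
                      2 * N / |β| * (∑ p₁ : GridPoint L N, ‖kernel ℂ (effAction ℂ ((hubbardGridSub L M β N).transpose *
                          normalCovariance L M (fun ks => uvSymbolCT L M β μ (klFlowFrameU L M β U μ (nScales β + 1)) (klScale klE0 (nScales β + 1)) ks /
                            (1 + uvSymbolCT L M β μ (klFlowFrameU L M β U μ (nScales β + 1)) (klScale klE0 (nScales β + 1)) ks *
                              (((klFlowFrameU L M β U μ (nScales β + 1)).eval (latticeMomentum L ks.1.2) / (β * (L : ℝ) ^ 2) : ℝ) : ℂ))) *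
                          hubbardGridSub L M β N) (hubbardGridInteraction L N β U)) 2
                          (fun j => ((![((w.1, fun _ : Fin 2 => (((L - 1) / 2 : ℕ) : ZMod L)) : GridPoint L N), p₁] j, 0), j))‖) ≤ B ∧
                      2 * N / |β| *
                        ((∑ p₁ : GridPoint L N, ‖kernel ℂ (effAction ℂ ((hubbardGridSub L M β N).transpose *
                            normalCovariance L M (fun ks => uvSymbolCT L M β μ (klFlowFrameU L M β U μ (nScales β + 1)) (klScale klE0 (nScales β + 1)) ks /
                              (1 + uvSymbolCT L M β μ (klFlowFrameU L M β U μ (nScales β + 1)) (klScale klE0 (nScales β + 1)) ks *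
                                (((klFlowFrameU L M β U μ (nScales β + 1)).eval (latticeMomentum L ks.1.2) / (β * (L : ℝ) ^ 2) : ℝ) : ℂ))) *
                            hubbardGridSub L M β N) (hubbardGridInteraction L N β U)) 2
                            (fun j => ((![((w.1, fun _ : Fin 2 => (((L - 1) / 2 : ℕ) : ZMod L)) : GridPoint L N), p₁] j, 0), j)) -
                          kernel ℂ (effAction ℂ ((hubbardGridSub L'' M β N).transpose *
                            normalCovariance L'' M (fun ks => uvSymbolCT L'' M β μ (klFlowFrameU L'' M β U μ (nScales β + 1)) (klScale klE0 (nScales β + 1)) ks /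
                              (1 + uvSymbolCT L'' M β μ (klFlowFrameU L'' M β U μ (nScales β + 1)) (klScale klE0 (nScales β + 1)) ks *
                                (((klFlowFrameU L'' M β U μ (nScales β + 1)).eval (latticeMomentum L'' ks.1.2) / (β * (L'' : ℝ) ^ 2) : ℝ) : ℂ))) *
                            hubbardGridSub L'' M β N) (hubbardGridInteraction L'' N β U)) 2
                            (fun j => ((![w, ((p₁.1, w.2 + Torus.proj L'' (Torus.cRep (p₁.2 - fun _ : Fin 2 => (((L - 1) / 2 : ℕ) : ZMod L)))) :
                              GridPoint L'' N)] j, 0), j))‖) +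
                        ∑ p₁' ∈ univ.filter (fun p₁' : GridPoint L'' N => p₁' ∉ Set.range (fun p : GridPoint L N =>
                            ((p.1, w.2 + Torus.proj L'' (Torus.cRep (p.2 - fun _ : Fin 2 => (((L - 1) / 2 : ℕ) : ZMod L)))) : GridPoint L'' N))),
                          ‖kernel ℂ (effAction ℂ ((hubbardGridSub L'' M β N).transpose *
                            normalCovariance L'' M (fun ks => uvSymbolCT L'' M β μ (klFlowFrameU L'' M β U μ (nScales β + 1)) (klScale klE0 (nScales β + 1)) ks /
                              (1 + uvSymbolCT L'' M β μ (klFlowFrameU L'' M β U μ (nScales β + 1)) (klScale klE0 (nScales β + 1)) ks *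
                                (((klFlowFrameU L'' M β U μ (nScales β + 1)).eval (latticeMomentum L'' ks.1.2) / (β * (L'' : ℝ) ^ 2) : ℝ) : ℂ))) *
                            hubbardGridSub L'' M β N) (hubbardGridInteraction L'' N β U)) 2 (fun j => ((![w, p₁'] j, 0), j))‖) ≤ δ L) :
    ∀ (G : GeoConsts) (P : SplitConsts) (Q : EngConsts) (R : RenConsts), G.WF → P.WF → Q.WF → R.WF →
      ∃ c₅ : ℝ, 0 < c₅ ∧ ∀ c : ℝ, 0 < c → c ≤ c₅ → ∃ U₀ : ℝ, 0 < U₀ ∧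
        ∀ μ ∈ klWindowC, ∀ U : ℝ, 0 < U → U ≤ U₀ → ∀ β : ℝ, klBetaMin ≤ β → β ≤ Real.exp (c / U ^ 2) →
          ∀ K : TrigPolyC4v, klPredsV17F2.frameOK R U (nScales β) μ K →
            ∀ (Lstar : ℕ) (Mstar : ℕ → ℕ), TowerP klPredsV17F2 G P Q R β U μ K Lstar Mstar →
              ∀ n : ℤ, ∃ L₀ : ℕ, ∃ ρ : ℕ → ℝ, Tendsto ρ atTop (𝓝 0) ∧
                ∀ (L : ℕ) [NeZero L], L₀ ≤ L → ∀ (L'' : ℕ) [NeZero L''], L ∣ L'' → ∃ M₀ : ℕ, ∀ (M : ℕ) [NeZero M], M₀ ≤ M →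
                  ∀ (ω : MatsubaraIdx M), matsubaraInt M ω = n → ∀ (k : TorusSite 2 L) (k'' : TorusSite 2 L''),
                    latticeMomentum L'' k'' = latticeMomentum L k →
                      ‖klSelfEnergy L M β U μ (klFlowFrameU L M β U μ (nScales β + 1)) klE0 (nScales β + 1) (ω, k) 0 -
                          klSelfEnergy L'' M β U μ (klFlowFrameU L'' M β U μ (nScales β + 1)) klE0 (nScales β + 1) (ω, k'') 0‖ ≤ ρ L := by
  intro G P Q R hG hP hQ hR
  obtain ⟨c₅, hc₅, hc⟩ := hD G P Q R hG hP hQ hR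
  refine ⟨c₅, hc₅, fun c hc0 hcc => ?_⟩
  obtain ⟨U₀, hU₀, hU⟩ := hc c hc0 hcc
  refine ⟨U₀, hU₀, fun μ hμ U hU0 hUU β hβmin hβmax K hK Lstar Mstar hT n => ?_⟩
  have hβ : 0 < β := pos_of_klBetaMin_le hβmin
  obtain ⟨L₀D, B, δ, hδ, hDn⟩ := hU μ hμ U hU0 hUU β hβmin hβmax K hK Lstar Mstar hT n
  -- fixed data at fixed `β`: the last scale, the frequency of the label, the symbol boxes
  have hΛ : 0 < klScale klE0 (nScales β + 1) := klth_klScale_pos _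
  set ν : ℝ := Real.pi * (2 * (n : ℝ) + 1) / β with hν_def
  have hν : ν ≠ 0 := by
    have h2 : (2 * (n : ℝ) + 1) ≠ 0 := by
      have : (2 * (n : ℝ) + 1) = ((2 * n + 1 : ℤ) : ℝ) := by push_cast; ring
      rw [this]
      exact_mod_cast (by omega : (2 * n + 1 : ℤ) ≠ 0)
    rw [hν_def]
    exact div_ne_zero (mul_ne_zero Real.pi_ne_zero h2) hβ.ne'
  set Kmax : ℝ := max 0 (∑ m ∈ range (nScales β + 1), R.Gfr 0 * uPow 0 U * (4 : ℝ) ^ ((((0 : ℕ) : ℤ) - 2) * (m : ℤ))) with hKmax_def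
  set Cfr : ℝ := |∑ m ∈ range (nScales β + 1), Q.CL β m| with hCfr_def
  have hCfr : 0 ≤ Cfr := abs_nonneg _
  set emax : ℝ := 4 + |μ| with hemax_def
  -- the explicit symbols as continuous functions of `(κ, e)`
  set Φu : ℝ × ℝ → ℂ := fun q => uvSymbolFn 1 (klScale klE0 (nScales β + 1)) (q.2 - q.1) ν with hΦu_def
  set ΦE : ℝ × ℝ → ℂ := fun q => (q.1 : ℂ) - (q.1 : ℂ) ^ 2 * (Φu q / (1 + Φu q * (q.1 : ℂ))) with hΦE_def
  set Φτ : ℝ × ℝ → ℂ := fun q => (1 - (q.1 : ℂ) * (Φu q / (1 + Φu q * (q.1 : ℂ)))) ^ 2 with hΦτ_def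
  have hcu : Continuous Φu :=
    (continuous_uvSymbolFn_band 1 hΛ ν).comp (continuous_snd.sub continuous_fst)
  have hden : ∀ q : ℝ × ℝ, (1 : ℂ) + Φu q * (q.1 : ℂ) ≠ 0 := fun q =>
    one_add_uvSymbolFn_mul_ne_zero hν 1 (klScale klE0 (nScales β + 1)) _ _
  have hc1 : Continuous fun q : ℝ × ℝ => (q.1 : ℂ) := Complex.continuous_ofReal.comp continuous_fst
  have hcq : Continuous fun q : ℝ × ℝ => Φu q / (1 + Φu q * (q.1 : ℂ)) := hcu.div (continuous_const.add (hcu.mul hc1)) hden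
  have hcE : Continuous ΦE := hc1.sub ((hc1.pow 2).mul hcq)
  have hcτ : Continuous Φτ := (continuous_const.sub (hc1.mul hcq)).pow 2
  set S : Set (ℝ × ℝ) := Set.Icc (-Kmax) Kmax ×ˢ Set.Icc (-emax) emax with hS_def
  have hS : IsCompact S := isCompact_Icc.prod isCompact_Icc
  have hUE : UniformContinuousOn ΦE S := hS.uniformContinuousOn_of_continuous hcE.continuousOn
  have hUτ : UniformContinuousOn Φτ S := hS.uniformContinuousOn_of_continuous hcτ.continuousOn
  obtain ⟨CE, hCE⟩ := hS.exists_bound_of_continuousOn hcE.continuousOn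
  obtain ⟨Cτ, hCτ⟩ := hS.exists_bound_of_continuousOn hcτ.continuousOn
  have hKmax0 : 0 ≤ Kmax := le_max_left _ _
  have hemax0 : 0 ≤ emax := by positivity
  have h0S : ((0 : ℝ), (0 : ℝ)) ∈ S := ⟨⟨by linarith, hKmax0⟩, ⟨by linarith, hemax0⟩⟩
  have hCτ0 : 0 ≤ Cτ := (norm_nonneg _).trans (hCτ _ h0S)
  -- one null rate for each symbol term
  obtain ⟨ηE, hηE, hηEP⟩ := exists_rate_of_forall_eps
    (P := fun (L : ℕ) (ε : ℝ) => ∀ κ κ' e : ℝ, |κ| ≤ Kmax → |κ'| ≤ Kmax → |e| ≤ emax → |κ - κ'| ≤ Cfr / L → ‖ΦE (κ, e) - ΦE (κ', e)‖ ≤ ε)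
    (B := CE + CE)
    (fun L κ κ' e hκ hκ' he _ => (norm_sub_le _ _).trans
      (add_le_add (hCE _ ⟨abs_le.1 hκ, abs_le.1 he⟩) (hCE _ ⟨abs_le.1 hκ', abs_le.1 he⟩)))
    (fun ε hε => exists_threshold_of_uniformContinuousOn hUE hCfr hε)
  obtain ⟨ητ, hητ, hητP⟩ := exists_rate_of_forall_eps
    (P := fun (L : ℕ) (ε : ℝ) => ∀ κ κ' e : ℝ, |κ| ≤ Kmax → |κ'| ≤ Kmax → |e| ≤ emax → |κ - κ'| ≤ Cfr / L → ‖Φτ (κ, e) - Φτ (κ', e)‖ ≤ ε)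
    (B := Cτ + Cτ)
    (fun L κ κ' e hκ hκ' he _ => (norm_sub_le _ _).trans
      (add_le_add (hCτ _ ⟨abs_le.1 hκ, abs_le.1 he⟩) (hCτ _ ⟨abs_le.1 hκ', abs_le.1 he⟩)))
    (fun ε hε => exists_threshold_of_uniformContinuousOn hUτ hCfr hε)
  -- the rate and the thresholds
  refine ⟨max L₀D Lstar, fun L => ηE L + ητ L * B + Cτ * δ L, ?_, fun L _ hL L'' _ hdvd => ?_⟩
  · have h := (hηE.add (hητ.mul_const B)).add (hδ.const_mul Cτ)
    simpa using h
  obtain ⟨b, hb⟩ := hdvd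
  have hb' : L'' = b * L := by rw [hb, mul_comm]
  have hL₀ : L₀D ≤ L := (le_max_left _ _).trans hL
  have hLs : Lstar ≤ L := (le_max_right _ _).trans hL
  have hLL'' : L ≤ L'' := Nat.le_of_dvd (Nat.pos_of_ne_zero (NeZero.ne L'')) ⟨b, hb⟩
  have hLs'' : Lstar ≤ L'' := hLs.trans hLL''
  obtain ⟨M₀D, hM₀D⟩ := hDn L hL₀ L'' b hb'
  refine ⟨max M₀D (max (max (Mstar L) (Mstar L'')) (max (Q.M0 β L) (Q.M0 β L''))), fun M _ hM ω hω k k'' hk => ?_⟩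
  have hM₀ : M₀D ≤ M := (le_max_left _ _).trans hM
  have hM₁ : Mstar L ≤ M := (le_max_left _ _).trans ((le_max_left _ _).trans ((le_max_right _ _).trans hM))
  have hM₁'' : Mstar L'' ≤ M := (le_max_right _ _).trans ((le_max_left _ _).trans ((le_max_right _ _).trans hM))
  have hM₂ : Q.M0 β L ≤ M := (le_max_left _ _).trans ((le_max_right _ _).trans ((le_max_right _ _).trans hM))
  have hM₂'' : Q.M0 β L'' ≤ M := (le_max_right _ _).trans ((le_max_right _ _).trans ((le_max_right _ _).trans hM))
  obtain ⟨N, instN, hN2, hN4, hZc, hZf, w, hw⟩ := hM₀D M hM₀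
  obtain ⟨hBω, hDefω⟩ := hw ω hω
  -- the read-out at the pin
  have key := TwoVolumeDefect.norm_klSelfEnergy_sub_le_gridDefect_pin hb' hβ hN2 hN4 U μ (klFlowFrameU L M β U μ (nScales β + 1))
    (klFlowFrameU L'' M β U μ (nScales β + 1)) (nScales β + 1) w ω 0 hZc hZf hk
  have hνeq : matsubaraFreq β M ω = ν := by rw [matsubaraFreq, hω]
  rw [hνeq] at key
  -- the symbol data at this momentum
  set p : Fin 2 → ℝ := latticeMomentum L k with hp_def
  set κ : ℝ := (klFlowFrameU L M β U μ (nScales β + 1)).eval p with hκ_def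
  set κ' : ℝ := (klFlowFrameU L'' M β U μ (nScales β + 1)).eval p with hκ'_def
  set e : ℝ := -2 * (∑ l : Fin 2, Real.cos (p l)) - μ with he_def
  have hκ : |κ| ≤ Kmax := (abs_eval_klFlowFrameU_le_of_towerV17F2 hT hLs hM₁ le_rfl p).trans (le_max_right _ _)
  have hκ' : |κ'| ≤ Kmax := (abs_eval_klFlowFrameU_le_of_towerV17F2 hT hLs'' hM₁'' le_rfl p).trans (le_max_right _ _)
  have he : |e| ≤ emax := by
    rw [he_def, hemax_def]
    have hc : |∑ l : Fin 2, Real.cos (p l)| ≤ 2 := by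
      refine (Finset.abs_sum_le_sum_abs _ _).trans ?_
      have : ∑ l : Fin 2, |Real.cos (p l)| ≤ ∑ _l : Fin 2, (1 : ℝ) := Finset.sum_le_sum fun l _ => Real.abs_cos_le_one _
      simpa using this
    calc |-2 * (∑ l : Fin 2, Real.cos (p l)) - μ| ≤ |-2 * ∑ l : Fin 2, Real.cos (p l)| + |μ| := abs_sub _ _
      _ = 2 * |∑ l : Fin 2, Real.cos (p l)| + |μ| := by rw [abs_mul, abs_neg, abs_two]
      _ ≤ 4 + |μ| := by linarith
  have hLpos : (0 : ℝ) < L := by exact_mod_cast Nat.pos_of_ne_zero (NeZero.ne L)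
  have hd : |κ - κ'| ≤ Cfr / L :=
    (flowFrames_twoVolume_of_towerV17F2 hμ hT hLs hLL'' hM₁ hM₂ hM₁'' hM₂'' le_rfl p).trans
      (div_le_div_of_nonneg_right (le_abs_self _) hLpos.le)
  have hT1 : ‖ΦE (κ, e) - ΦE (κ', e)‖ ≤ ηE L := hηEP L κ κ' e hκ hκ' he hd
  have hT2 : ‖Φτ (κ, e) - Φτ (κ', e)‖ ≤ ητ L := hητP L κ κ' e hκ hκ' he hd
  have hT3 : ‖Φτ (κ', e)‖ ≤ Cτ := hCτ _ ⟨abs_le.1 hκ', abs_le.1 he⟩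
  refine key.trans ?_
  refine add_le_add (add_le_add hT1 (mul_le_mul hT2 hBω (by positivity) ((norm_nonneg _).trans hT2))) ?_
  exact mul_le_mul hT3 hDefω (by positivity) hCτ0

/-! ## §3 The VL child text -/

/-- **THE VL CHILD `KLRegimeVolumeLimitV17F2`'s TEXT FROM THE LAST-SCALE PINNED GRID DEFECT** (`framedNestedFlowTextV17F2_of_lastScaleGridDefectText`
∘ `volumeLimitTextV17F2_of_framedNestedFlowText`). [cite: BenfattoGiulianiMastropietro2006, §2.4 (2.38)] -/
theorem volumeLimitTextV17F2_of_lastScaleGridDefectText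
    (hD : ∀ (G : GeoConsts) (P : SplitConsts) (Q : EngConsts) (R : RenConsts), G.WF → P.WF → Q.WF → R.WF →
      ∃ c₅ : ℝ, 0 < c₅ ∧ ∀ c : ℝ, 0 < c → c ≤ c₅ → ∃ U₀ : ℝ, 0 < U₀ ∧
        ∀ μ ∈ klWindowC, ∀ U : ℝ, 0 < U → U ≤ U₀ → ∀ β : ℝ, klBetaMin ≤ β → β ≤ Real.exp (c / U ^ 2) →
          ∀ K : TrigPolyC4v, klPredsV17F2.frameOK R U (nScales β) μ K →
            ∀ (Lstar : ℕ) (Mstar : ℕ → ℕ), TowerP klPredsV17F2 G P Q R β U μ K Lstar Mstar →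
              ∀ n : ℤ, ∃ L₀ : ℕ, ∃ B : ℝ, ∃ δ : ℕ → ℝ, Tendsto δ atTop (𝓝 0) ∧
                ∀ (L : ℕ) [NeZero L], L₀ ≤ L → ∀ (L'' : ℕ) [NeZero L''] (b : ℕ), L'' = b * L → ∃ M₀ : ℕ, ∀ (M : ℕ) [NeZero M], M₀ ≤ M →
                  ∃ (N : ℕ) (_ : NeZero N), 2 * M ≤ N ∧ 4 * M ≤ N + 1 ∧
                    IsUnit (effPartitionFn ℂ (normalCovariance L M (uvSymbolCT L M β μ (klFlowFrameU L M β U μ (nScales β + 1))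
                      (klScale klE0 (nScales β + 1))))
                      (hubbardInteraction L M β U + counterQuadratic L M β (klFlowFrameU L M β U μ (nScales β + 1)))) ∧
                    IsUnit (effPartitionFn ℂ (normalCovariance L'' M (uvSymbolCT L'' M β μ (klFlowFrameU L'' M β U μ (nScales β + 1))
                      (klScale klE0 (nScales β + 1))))
                      (hubbardInteraction L'' M β U + counterQuadratic L'' M β (klFlowFrameU L'' M β U μ (nScales β + 1)))) ∧
                    ∃ w : GridPoint L'' N, ∀ ω : MatsubaraIdx M, matsubaraInt M ω = n →
                      2 * N / |β| * (∑ p₁ : GridPoint L N, ‖kernel ℂ (effAction ℂ ((hubbardGridSub L M β N).transpose *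
                          normalCovariance L M (fun ks => uvSymbolCT L M β μ (klFlowFrameU L M β U μ (nScales β + 1)) (klScale klE0 (nScales β + 1)) ks /
                            (1 + uvSymbolCT L M β μ (klFlowFrameU L M β U μ (nScales β + 1)) (klScale klE0 (nScales β + 1)) ks *
                              (((klFlowFrameU L M β U μ (nScales β + 1)).eval (latticeMomentum L ks.1.2) / (β * (L : ℝ) ^ 2) : ℝ) : ℂ))) *
                          hubbardGridSub L M β N) (hubbardGridInteraction L N β U)) 2
                          (fun j => ((![((w.1, fun _ : Fin 2 => (((L - 1) / 2 : ℕ) : ZMod L)) : GridPoint L N), p₁] j, 0), j))‖) ≤ B ∧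
                      2 * N / |β| *
                        ((∑ p₁ : GridPoint L N, ‖kernel ℂ (effAction ℂ ((hubbardGridSub L M β N).transpose *
                            normalCovariance L M (fun ks => uvSymbolCT L M β μ (klFlowFrameU L M β U μ (nScales β + 1)) (klScale klE0 (nScales β + 1)) ks /
                              (1 + uvSymbolCT L M β μ (klFlowFrameU L M β U μ (nScales β + 1)) (klScale klE0 (nScales β + 1)) ks *
                                (((klFlowFrameU L M β U μ (nScales β + 1)).eval (latticeMomentum L ks.1.2) / (β * (L : ℝ) ^ 2) : ℝ) : ℂ))) *
                            hubbardGridSub L M β N) (hubbardGridInteraction L N β U)) 2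
                            (fun j => ((![((w.1, fun _ : Fin 2 => (((L - 1) / 2 : ℕ) : ZMod L)) : GridPoint L N), p₁] j, 0), j)) -
                          kernel ℂ (effAction ℂ ((hubbardGridSub L'' M β N).transpose *
                            normalCovariance L'' M (fun ks => uvSymbolCT L'' M β μ (klFlowFrameU L'' M β U μ (nScales β + 1)) (klScale klE0 (nScales β + 1)) ks /
                              (1 + uvSymbolCT L'' M β μ (klFlowFrameU L'' M β U μ (nScales β + 1)) (klScale klE0 (nScales β + 1)) ks *
                                (((klFlowFrameU L'' M β U μ (nScales β + 1)).eval (latticeMomentum L'' ks.1.2) / (β * (L'' : ℝ) ^ 2) : ℝ) : ℂ))) *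
                            hubbardGridSub L'' M β N) (hubbardGridInteraction L'' N β U)) 2
                            (fun j => ((![w, ((p₁.1, w.2 + Torus.proj L'' (Torus.cRep (p₁.2 - fun _ : Fin 2 => (((L - 1) / 2 : ℕ) : ZMod L)))) :
                              GridPoint L'' N)] j, 0), j))‖) +
                        ∑ p₁' ∈ univ.filter (fun p₁' : GridPoint L'' N => p₁' ∉ Set.range (fun p : GridPoint L N =>
                            ((p.1, w.2 + Torus.proj L'' (Torus.cRep (p.2 - fun _ : Fin 2 => (((L - 1) / 2 : ℕ) : ZMod L)))) : GridPoint L'' N))),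
                          ‖kernel ℂ (effAction ℂ ((hubbardGridSub L'' M β N).transpose *
                            normalCovariance L'' M (fun ks => uvSymbolCT L'' M β μ (klFlowFrameU L'' M β U μ (nScales β + 1)) (klScale klE0 (nScales β + 1)) ks /
                              (1 + uvSymbolCT L'' M β μ (klFlowFrameU L'' M β U μ (nScales β + 1)) (klScale klE0 (nScales β + 1)) ks *
                                (((klFlowFrameU L'' M β U μ (nScales β + 1)).eval (latticeMomentum L'' ks.1.2) / (β * (L'' : ℝ) ^ 2) : ℝ) : ℂ))) *
                            hubbardGridSub L'' M β N) (hubbardGridInteraction L'' N β U)) 2 (fun j => ((![w, p₁'] j, 0), j))‖) ≤ δ L) :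
    VolumeLimitP2 klPredsV17F2 FinalTwoLegVolLimitEx klWindowC :=
  volumeLimitTextV17F2_of_framedNestedFlowText (framedNestedFlowTextV17F2_of_lastScaleGridDefectText hD)

end Summit.HubbardSuperconductivity.HubbardSuperconductivity.Theorems.TwoPointAssembly
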